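import Summits.AtomisticToContinuum.BoseEinsteinCondensation.Theses.BECPopovBerryRG

/-!
# AtomisticToContinuum / BoseEinsteinCondensation — route `BECPopovBerryRG`, assembly

Settles the assembly item `stmt-AtomisticToContinuum-13938` of route
`route-AtomisticToContinuum-BECPopovBerryRG`: the implication
`BerryStiffPhaseOS → BlockOccupationLD → PolarTransferOS → BlockCoherenceToPeriodicBEC →
BoundaryTransferWeak → BoseEinsteinCondensation`.

The hypotheses of `Assembly` are, verbatim and in the same order, those of the route's deciding
theorem `closes`, so the assembly is that theorem curried; the composition is spelled out again
below for the record: for a repulsive finite-range potential `v`, `PolarTransferOS` fed with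
`BlockOccupationLD` and the engine `BerryStiffPhaseOS` gives `BlockPhaseCoherence`, which the glue
`BlockCoherenceToPeriodicBEC` turns into periodic constant-mode BEC for `v`, which
`BoundaryTransferWeak` transfers to ground-state (Dirichlet) BEC for `v` at all small densities —
the body of the sub-problem statement `BoseEinsteinCondensation`. Pure logic; no analytic content
lives here.
-/

namespace Summit.AtomisticToContinuum.BoseEinsteinCondensation.Theorems

/-- Settles `stmt-AtomisticToContinuum-13938` (exact signature): the assembly of route
`BECPopovBerryRG`, i.e. its five items imply the sub-problem statement
`BoseEinsteinCondensation`. Proof: for each admissible `v`, `BoundaryTransferWeak` applied to the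
periodic BEC produced by `BlockCoherenceToPeriodicBEC` from the block phase coherence delivered by
`PolarTransferOS` (fed with `BlockOccupationLD` and `BerryStiffPhaseOS`). [folklore] -/
theorem becPopovBerryRG_assembly_proof :
    Summit.AtomisticToContinuum.BoseEinsteinCondensation.Theses.BECPopovBerryRG.Assembly := by
  unfold Theses.BECPopovBerryRG.Assembly
  intro hE hLD hT hG hB
  exact fun v hv => hB v hv (hG (hT hLD hE) v hv)

end Summit.AtomisticToContinuum.BoseEinsteinCondensation.Theorems
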